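import Summits.CriticalPhenomena.PercolationContinuityZ3.Theorems.PercNearOneGluingNoHeavyLowerTailSunflowerLinkedCurrencyVoluntary
import HarnessLib

/-!
# `NoHeavyLowerTail` (crux stmt-CriticalPhenomena-4575), abstract sunflower cubic: the linked two-currency lemma with
# voluntary `h`-excess, SHARP form (no hypothesis on the `Ȳ`-usage) — the "no free `g`" half of (RES0′) for every `κ`

Support file (seat `prim-ineq-prove-1` gen 54; `--supports stmt-CriticalPhenomena-4575`); imports `…SunflowerLinkedCurrencyVoluntary`
(gen 54: `vol_K1`, `vol_stepKey`, `vol_Ebound`).  Memo: run/shared/lean/prim/prim-ineq-prove-1/FINDING-FREEH-prove1-g54.md §8–§9.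
* **`linked_two_currency_voluntary_sharp`** — same petals as `linked_two_currency_voluntary` (excesses `a_j, m_j, e_j ≥ 0`,
  links `ρ m_j ≤ a_j`, `ε_h m_j ≤ ε_g e_j`, caps `ε_H ≤ (1/ε_Y − 1)ρε_g`, `ε_H + ρε_g ≤ 1`), but the hypothesis
  `ε_h 𝒜 ≤ ε_g` on the `Ȳ`-usage `𝒜 = ε_Y(∏(1+a_j/ε_Y) − 1)` is replaced by `(ε_h − ν) 𝒜 ≤ ε_g` for a parameter `ν ≥ 0`
  (vacuous for `ν ≥ ε_h`), at the price of the cross credit `ν 𝒜 (R − 1)`: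
  `∏(1 + a_j + m_j + e_j) ≤ 1 + 𝒜 + ε_H (R − 1) + ν 𝒜 (R − 1)`, `R = ∏(1 + e_j/ε_h)`  (ν = 0 is gen 54's lemma).
* CAVEAT (memo §9): the caps are relative to the LINK constant `ρ` (`ε_Y ≤ ρε_g/(ρε_g + ε_H)`); in the section model with
  `κ = α₀₁/α₁₁ < 1` this is STRONGER than the leaf-leaf cap `ε_Y ≤ τ′` (they coincide for `κ = 1`), so the lemma does not by
  itself settle the "no free `g`" families of (RES0′) for `κ < 1`; it is the abstract tool, with the `Ȳ`-usage hypothesis of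
  gen 54's lemma removed.
Proof: gen 54's ordered-increment induction; the extra term of the increment,
`N = ν[(𝒜 + aX)(Rr − 1) − 𝒜(R−1)(1+a+m+e)] ≥ ν𝒜e/ε_h` (`vol_N_lower`), pays exactly the deficit `e(𝒜 − ε_g/ε_h)` of the
`h`-heavy steps (`vol_stepF_sharp`); the `Ȳ`-heavy steps are unchanged (`vol_stepKey`, `vol_Ebound`).
-/

noncomputable section

namespace Summit.CriticalPhenomena.PercolationContinuityZ3.Theorems.SunflowerPartition

namespace SafeCalc

namespace LinkedCurrency

open Finset

variable {κ : Type*}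

/-- Step (i♯): with the cross credit `ν 𝒜 e` the `h`-heavy step needs only `(ε_h − ν)𝒜 ≤ ε_g` instead of `ε_h𝒜 ≤ ε_g`:
`0 ≤ (ε_g e − ε_h m) + ε_h 𝒜 (aQ − m − e) + ν 𝒜 e`.  Identity:
`ρε_g·(…) = ρ(ε_g e − ε_h m)(ε_g − 𝒜(ε_h − ν)) + ε_h𝒜(a(Qρε_g − ε_H) + ε_H(a − ρm)) + ρ ε_h 𝒜 m ν`. [this work] -/
theorem vol_stepF_sharp {εg εh ρ Q ν 𝒜 a m e : ℝ} (hεg : 0 < εg) (hεh : 0 < εh) (hρ : 0 < ρ)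
    (hQ : εg + εh ≤ Q * (ρ * εg)) (h𝒜 : 0 ≤ 𝒜) (hν : 0 ≤ ν) (hHν : (εh - ν) * 𝒜 ≤ εg) (ha : 0 ≤ a) (hm : 0 ≤ m)
    (hlink : ρ * m ≤ a) (hunl : εh * m ≤ εg * e) :
    0 ≤ (εg * e - εh * m) + εh * 𝒜 * (a * Q - m - e) + ν * 𝒜 * e := by
  have key : ρ * εg * ((εg * e - εh * m) + εh * 𝒜 * (a * Q - m - e) + ν * 𝒜 * e) =
      ρ * (εg * e - εh * m) * (εg - 𝒜 * (εh - ν)) +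
        εh * 𝒜 * (a * (Q * (ρ * εg) - (εg + εh)) + (εg + εh) * (a - ρ * m)) + ρ * εh * 𝒜 * m * ν := by ring
  have h1 : 0 ≤ ρ * (εg * e - εh * m) * (εg - 𝒜 * (εh - ν)) :=
    mul_nonneg (mul_nonneg hρ.le (by linarith)) (by nlinarith)
  have h2 : 0 ≤ εh * 𝒜 * (a * (Q * (ρ * εg) - (εg + εh)) + (εg + εh) * (a - ρ * m)) :=
    mul_nonneg (mul_nonneg hεh.le h𝒜)
      (add_nonneg (mul_nonneg ha (by linarith)) (mul_nonneg (by linarith) (by linarith)))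
  have h3 : 0 ≤ ρ * εh * 𝒜 * m * ν := by positivity
  exact (mul_nonneg_iff_of_pos_left (mul_pos hρ hεg)).1 (key ▸ add_nonneg (add_nonneg h1 h2) h3)

/-- The cross-credit increment is at least `ν 𝒜 e`:  with `X ≥ 1 + 𝒜(Q+1)` (the `Ȳ`-product of the prefix),
`R ≥ 1`, `m ≤ aQ`, `ε_h ≤ 1`:
`ν 𝒜 e ≤ ε_h · ν[(𝒜 + aX)(R(1 + e/ε_h) − 1) − 𝒜(R − 1)(1 + a + m + e)]`.  Identity:
`ε_h N − ν𝒜e = ν(R−1)(𝒜e(1−ε_h) + ε_h(aX − a𝒜 − 𝒜m)) + ν a X R e`. [this work] -/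
theorem vol_N_lower {εh Q ν 𝒜 a m e X R : ℝ} (hν : 0 ≤ ν) (h𝒜 : 0 ≤ 𝒜) (ha : 0 ≤ a) (he : 0 ≤ e)
    (hεh : 0 < εh) (hεh1 : εh ≤ 1) (hR : 1 ≤ R) (hX1 : 1 ≤ X) (hX : 1 + 𝒜 * (Q + 1) ≤ X) (hmQ : m ≤ a * Q) :
    ν * 𝒜 * e ≤ εh * (ν * ((𝒜 + a * X) * (R * (1 + e / εh) - 1) - 𝒜 * (R - 1) * (1 + a + m + e))) := by
  have hεhne : εh ≠ 0 := hεh.ne'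
  have iden : εh * (ν * ((𝒜 + a * X) * (R * (1 + e / εh) - 1) - 𝒜 * (R - 1) * (1 + a + m + e))) - ν * 𝒜 * e =
      ν * (R - 1) * (𝒜 * e * (1 - εh) + εh * (a * X - a * 𝒜 - 𝒜 * m)) + ν * a * X * R * e := by
    field_simp
    ring
  have h1 : 0 ≤ a * X - a * 𝒜 - 𝒜 * m := by
    have h2 : a * (1 + 𝒜 * (Q + 1)) ≤ a * X := mul_le_mul_of_nonneg_left hX ha
    have h3 : 𝒜 * m ≤ 𝒜 * (a * Q) := mul_le_mul_of_nonneg_left hmQ h𝒜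
    nlinarith
  have h4 : 0 ≤ ν * (R - 1) * (𝒜 * e * (1 - εh) + εh * (a * X - a * 𝒜 - 𝒜 * m)) + ν * a * X * R * e := by
    have hX0 : 0 ≤ X := by linarith
    have t1 : 0 ≤ ν * (R - 1) * (𝒜 * e * (1 - εh) + εh * (a * X - a * 𝒜 - 𝒜 * m)) :=
      mul_nonneg (mul_nonneg hν (by linarith))
        (add_nonneg (mul_nonneg (mul_nonneg h𝒜 he) (by linarith)) (mul_nonneg hεh.le h1))
    have t2 : 0 ≤ ν * a * X * R * e :=
      mul_nonneg (mul_nonneg (mul_nonneg (mul_nonneg hν ha) hX0) (by linarith)) he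
    linarith
  linarith [iden]

/-! ## The theorem -/

set_option maxHeartbeats 800000 in
/-- **LINKED TWO-CURRENCY LEMMA WITH VOLUNTARY `h`-EXCESS, SHARP FORM (every number of petals).**
Parameters `ε_Y, ε_g, ε_h > 0` with `ε_g + ε_h < 1`, `ρ > 0`, the two caps `ε_g + ε_h ≤ (1/ε_Y − 1)·ρ ε_g` and
`ε_g + ε_h + ρ ε_g ≤ 1`, and a cross-credit rate `ν ≥ 0`.  Petals `j ∈ S` with excesses `a_j, m_j, e_j ≥ 0`, linked by
`ρ m_j ≤ a_j` and `ε_h m_j ≤ ε_g e_j` (no free `g`), whose `Ȳ`-usage `𝒜 = ε_Y(∏(1 + a_j/ε_Y) − 1)` satisfies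
`(ε_h − ν)·𝒜 ≤ ε_g` (vacuous when `ν ≥ ε_h`).  Then, with `R = ∏(1 + e_j/ε_h)`,
`∏ (1 + a_j + m_j + e_j) ≤ 1 + 𝒜 + (ε_g + ε_h)(R − 1) + ν·𝒜·(R − 1)`.
For `ν = 0` this is `linked_two_currency_voluntary`; the cross credit `ν𝒜(R−1)` buys the weaker hypothesis.
Proof: the same ordered-increment induction; the increment gains `N ≥ ν𝒜e_j/ε_h` (`vol_N_lower`), which pays the deficit of
the `h`-heavy steps (`vol_stepF_sharp`); the `Ȳ`-heavy steps use `vol_stepKey`/`vol_Ebound` unchanged. [this work] -/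
theorem linked_two_currency_voluntary_sharp [DecidableEq κ] {εY εg εh ρ ν : ℝ} (hεY : 0 < εY) (hεg : 0 < εg)
    (hεh : 0 < εh) (hH1 : εg + εh < 1) (hρ : 0 < ρ) (hcap1 : εg + εh ≤ (1 / εY - 1) * (ρ * εg))
    (hcap2 : εg + εh + ρ * εg ≤ 1) (a m e : κ → ℝ) (S : Finset κ) (ha : ∀ j ∈ S, 0 ≤ a j)
    (hm : ∀ j ∈ S, 0 ≤ m j) (he : ∀ j ∈ S, 0 ≤ e j) (hlink : ∀ j ∈ S, ρ * m j ≤ a j)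
    (hunl : ∀ j ∈ S, εh * m j ≤ εg * e j) (hν : 0 ≤ ν)
    (hHν : (εh - ν) * (εY * (∏ j ∈ S, (1 + a j / εY) - 1)) ≤ εg) :
    ∏ j ∈ S, (1 + a j + m j + e j) ≤
      1 + εY * (∏ j ∈ S, (1 + a j / εY) - 1) + (εg + εh) * (∏ j ∈ S, (1 + e j / εh) - 1) +
        ν * (εY * (∏ j ∈ S, (1 + a j / εY) - 1)) * (∏ j ∈ S, (1 + e j / εh) - 1) := by
  -- scalar consequences of the caps, in `λ = 1/ρ` form
  obtain ⟨lam, hlam_def⟩ : ∃ v : ℝ, v = 1 / ρ := ⟨_, rfl⟩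
  have hlam : 0 ≤ lam := by rw [hlam_def]; positivity
  have hρlam : ρ * lam = 1 := by rw [hlam_def]; field_simp
  have hs1 : (εg + εh) * lam ≤ (1 / εY - 1) * εg := by
    have h := mul_le_mul_of_nonneg_right hcap1 hlam
    calc (εg + εh) * lam ≤ (1 / εY - 1) * (ρ * εg) * lam := h
      _ = (1 / εY - 1) * εg * (ρ * lam) := by ring
      _ = (1 / εY - 1) * εg := by rw [hρlam, mul_one]
  have hs2 : εg ≤ lam * (1 - (εg + εh)) := by
    have h1 : ρ * εg ≤ 1 - (εg + εh) := by linarith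
    have h := mul_le_mul_of_nonneg_left h1 hlam
    calc εg = lam * (ρ * εg) := by rw [← mul_assoc, mul_comm lam, hρlam, one_mul]
      _ ≤ lam * (1 - (εg + εh)) := h
  have hcapY : εY * (1 + lam) ≤ 1 - εh := by
    have e1 : (1 - εh) * (εg + (εg + εh) * lam) - (1 + lam) * εg = εh * (lam * (1 - (εg + εh)) - εg) := by ring
    have e2 : 0 ≤ εh * (lam * (1 - (εg + εh)) - εg) := mul_nonneg hεh.le (by linarith)
    have e3 : (1 - εh) * ((εg + εh) * lam) ≤ (1 - εh) * ((1 / εY - 1) * εg) :=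
      mul_le_mul_of_nonneg_left hs1 (by linarith)
    have e4 : (1 - εh) * ((1 / εY - 1) * εg) = (1 - εh) * εg / εY - (1 - εh) * εg := by ring
    have e5 : (1 + lam) * εg ≤ (1 - εh) * εg / εY := by linarith
    rw [le_div_iff₀ hεY] at e5
    have e6 : εY * (1 + lam) * εg ≤ (1 - εh) * εg := by linarith
    exact le_of_mul_le_mul_right e6 hεg
  -- induction over the family in increasing order of the h-share
  suffices key : ∀ T, T ⊆ S → ∏ j ∈ T, (1 + a j + m j + e j) ≤
      1 + εY * (∏ j ∈ T, (1 + a j / εY) - 1) + (εg + εh) * (∏ j ∈ T, (1 + e j / εh) - 1) +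
        ν * (εY * (∏ j ∈ T, (1 + a j / εY) - 1)) * (∏ j ∈ T, (1 + e j / εh) - 1) from key S subset_rfl
  intro T
  refine Finset.induction_on_max_value (fun j => e j / (a j + m j + e j)) T (by intro; simp) ?_
  intro j T hjT hmax IH hsub
  have hjS : j ∈ S := hsub (mem_insert_self j T)
  have hTS : T ⊆ S := fun i hi => hsub (mem_insert_of_mem hi)
  have IH' := IH hTS
  -- the running products
  obtain ⟨X, hXdef⟩ : ∃ v : ℝ, v = ∏ i ∈ T, (1 + a i / εY) := ⟨_, rfl⟩
  obtain ⟨R, hRdef⟩ : ∃ v : ℝ, v = ∏ i ∈ T, (1 + e i / εh) := ⟨_, rfl⟩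
  rw [← hXdef, ← hRdef] at IH'
  have hX1 : 1 ≤ X := hXdef ▸ one_le_prod_one_add_div hεY T a fun i hi => ha i (hTS hi)
  have hR1 : 1 ≤ R := hRdef ▸ one_le_prod_one_add_div hεh T e fun i hi => he i (hTS hi)
  have h𝒜 : 0 ≤ εY * (X - 1) := mul_nonneg hεY.le (by linarith)
  have hℰ : 0 ≤ (εg + εh) * (R - 1) := mul_nonneg (by linarith) (by linarith)
  -- X ≤ X_S, hence the hypothesis (Hν) for the prefix
  have hXS : X ≤ ∏ i ∈ S, (1 + a i / εY) := by
    rw [← prod_sdiff hTS, ← hXdef]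
    have h1 : (1:ℝ) ≤ ∏ i ∈ S \ T, (1 + a i / εY) :=
      one_le_prod_one_add_div hεY _ a fun i hi => ha i (sdiff_subset hi)
    have h2 := mul_le_mul_of_nonneg_right h1 (le_trans zero_le_one hX1)
    linarith
  have hHνT : (εh - ν) * (εY * (X - 1)) ≤ εg := by
    rcases le_or_gt 0 (εh - ν) with hpos | hneg
    · have : (εh - ν) * (εY * (X - 1)) ≤ (εh - ν) * (εY * (∏ i ∈ S, (1 + a i / εY) - 1)) :=
        mul_le_mul_of_nonneg_left (mul_le_mul_of_nonneg_left (by linarith) hεY.le) hpos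
      linarith
    · have : (εh - ν) * (εY * (X - 1)) ≤ 0 := mul_nonpos_of_nonpos_of_nonneg hneg.le h𝒜
      linarith
  -- petal j data
  have haj := ha j hjS; have hmj := hm j hjS; have hej := he j hjS
  have hVj : 0 ≤ 1 + a j + m j + e j := by linarith
  rw [prod_insert hjT, prod_insert hjT, prod_insert hjT, ← hXdef, ← hRdef]
  -- step inequality  ε_h · (Φ♯_{T+j} − V_j Φ♯_T) = ε_h Δ + ε_h N ≥ 0
  have hF := vol_stepF_sharp (Q := 1 / εY - 1) hεg hεh hρ hcap1 h𝒜 hν hHνT haj hmj (hlink j hjS) (hunl j hjS)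
  have hXQ : 1 + εY * (X - 1) * (1 / εY - 1 + 1) ≤ X := by
    have h1 : εY * (X - 1) * (1 / εY - 1 + 1) = X - 1 := by field_simp; ring
    linarith
  have hQρ : 1 ≤ (1 / εY - 1) * ρ := by
    have h2 : 1 * εg ≤ (1 / εY - 1) * ρ * εg := by nlinarith [hcap1]
    exact le_of_mul_le_mul_right h2 hεg
  have hQ0 : 0 ≤ 1 / εY - 1 := by
    by_contra hneg
    have : (1 / εY - 1) * ρ < 0 := mul_neg_of_neg_of_pos (lt_of_not_ge hneg) hρ
    linarith
  have hmQ : m j ≤ a j * (1 / εY - 1) := by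
    have h1 : ρ * m j * (1 / εY - 1) ≤ a j * (1 / εY - 1) := mul_le_mul_of_nonneg_right (hlink j hjS) hQ0
    have h2 : m j * 1 ≤ m j * ((1 / εY - 1) * ρ) := mul_le_mul_of_nonneg_left hQρ hmj
    nlinarith
  have hN := vol_N_lower (Q := 1 / εY - 1) hν h𝒜 haj hej hεh (by linarith) hR1 hX1 hXQ hmQ
  have hΔ : 0 ≤ (εg * e j - εh * m j) + εh * (εY * (X - 1)) * (a j * (1 / εY - 1) - m j - e j) +
      (εg + εh) * (R - 1) * (e j - εh * (a j + m j + e j)) +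
      εh * (ν * ((εY * (X - 1) + a j * X) * (R * (1 + e j / εh) - 1) -
        εY * (X - 1) * (R - 1) * (1 + a j + m j + e j))) := by
    by_cases hβ : 0 ≤ e j - εh * (a j + m j + e j)
    · have h1 := mul_nonneg hℰ hβ
      linarith
    · have hβ' : e j - εh * (a j + m j + e j) < 0 := lt_of_not_ge hβ
      have hN0 : 0 ≤ εh * (ν * ((εY * (X - 1) + a j * X) * (R * (1 + e j / εh) - 1) -
          εY * (X - 1) * (R - 1) * (1 + a j + m j + e j))) := by
        have : 0 ≤ ν * (εY * (X - 1)) * e j := mul_nonneg (mul_nonneg hν h𝒜) hej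
        linarith
      suffices hΔ0 : 0 ≤ (εg * e j - εh * m j) + εh * (εY * (X - 1)) * (a j * (1 / εY - 1) - m j - e j) +
          (εg + εh) * (R - 1) * (e j - εh * (a j + m j + e j)) by linarith
      have hb1 : e j * (1 - εh) < εh * (a j + m j) := by linarith
      have hP : 0 < a j + m j := by
        have h0 : 0 ≤ e j * (1 - εh) := mul_nonneg hej (by linarith)
        exact pos_of_mul_pos_right (lt_of_le_of_lt h0 hb1) hεh.le
      -- θ : the predecessors' h-usage per unit of Ȳ-excess
      obtain ⟨θ, hθdef⟩ : ∃ v : ℝ, v = e j * (1 + lam) / ((a j + m j) * εh) := ⟨_, rfl⟩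
      have hθ : 0 ≤ θ := by rw [hθdef]; positivity
      have hεYθ : εY * θ ≤ 1 := by
        rw [hθdef, ← mul_div_assoc, div_le_one (mul_pos hP hεh)]
        have h2 : εY * (1 + lam) * e j ≤ (1 - εh) * e j := mul_le_mul_of_nonneg_right hcapY hej
        linarith
      have hdom : ∀ i ∈ T, e i ≤ εh * θ * a i := by
        intro i hi
        have hiS := hTS hi
        have hai := ha i hiS; have hmi := hm i hiS; have hei := he i hiS
        have hθa : εh * θ * a i = e j * (1 + lam) * a i / (a j + m j) := by
          rw [hθdef]; field_simp
        rw [hθa, le_div_iff₀ hP]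
        -- from the h-share order: e_i (a_j + m_j) ≤ e_j (a_i + m_i) ≤ e_j a_i (1 + lam)
        have hord := hmax i hi
        have hmi' : m i ≤ lam * a i := by
          calc m i = lam * (ρ * m i) := by rw [← mul_assoc, mul_comm lam ρ, hρlam, one_mul]
            _ ≤ lam * a i := mul_le_mul_of_nonneg_left (hlink i hiS) hlam
        rcases eq_or_lt_of_le (show 0 ≤ a i + m i + e i by linarith) with h0 | hpos
        · have hei0 : e i = 0 := by linarith
          rw [hei0, zero_mul]; positivity
        · have htotj : 0 < a j + m j + e j := by linarith
          have hord' := (div_le_div_iff₀ hpos htotj).1 hord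
          have hm2 : e j * m i ≤ e j * (lam * a i) := mul_le_mul_of_nonneg_left hmi' hej
          linarith
      have hEb := vol_Ebound hεY hεh hθ hεYθ T a e (fun i hi => ha i (hTS hi)) (fun i hi => he i (hTS hi)) hdom
      rw [← hXdef, ← hRdef] at hEb
      -- ℰ ≤ εH θ 𝒜
      have hℰb : (εg + εh) * (R - 1) ≤ (εg + εh) * θ * (εY * (X - 1)) := by
        rw [mul_assoc]
        exact mul_le_mul_of_nonneg_left hEb (by linarith)
      have hK := vol_stepKey (Q := 1 / εY - 1) hεg hεh hH1 hs1 hs2 hlam h𝒜 haj hP (hunl j hjS)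
      -- ℰ β ≥ εH θ 𝒜 β since β < 0
      have h1 : (εg + εh) * θ * (εY * (X - 1)) * (e j - εh * (a j + m j + e j)) ≤
          (εg + εh) * (R - 1) * (e j - εh * (a j + m j + e j)) :=
        mul_le_mul_of_nonpos_right hℰb hβ'.le
      have h2 : (εg + εh) * (e j * (1 + lam) / (a j + m j)) * (εY * (X - 1)) * (e j - εh * (a j + m j + e j)) =
          εh * ((εg + εh) * θ * (εY * (X - 1)) * (e j - εh * (a j + m j + e j))) := by
        rw [hθdef]
        field_simp
      rw [h2] at hK
      have h3 : 0 ≤ εh * ((εg * e j - εh * m j) + εh * (εY * (X - 1)) * (a j * (1 / εY - 1) - m j - e j) +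
          (εg + εh) * θ * (εY * (X - 1)) * (e j - εh * (a j + m j + e j))) := by
        have h4 : εh * ((εg * e j - εh * m j) + εh * (εY * (X - 1)) * (a j * (1 / εY - 1) - m j - e j) +
            (εg + εh) * θ * (εY * (X - 1)) * (e j - εh * (a j + m j + e j))) =
            εh * (εg * e j - εh * m j) + εh ^ 2 * (εY * (X - 1)) * (a j * (1 / εY - 1) - m j - e j) +
            εh * ((εg + εh) * θ * (εY * (X - 1)) * (e j - εh * (a j + m j + e j))) := by ring
        rw [h4]; exact hK
      have h4 := (mul_nonneg_iff_of_pos_left hεh).1 h3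
      linarith
  -- the identity  ε_h (Φ♯_{T+j} − V_j Φ♯_T) = ε_h Δ + ε_h N
  have hid : εh * ((1 + εY * ((1 + a j / εY) * X - 1) + (εg + εh) * ((1 + e j / εh) * R - 1) +
      ν * (εY * ((1 + a j / εY) * X - 1)) * ((1 + e j / εh) * R - 1)) -
      (1 + a j + m j + e j) * (1 + εY * (X - 1) + (εg + εh) * (R - 1) + ν * (εY * (X - 1)) * (R - 1))) =
      (εg * e j - εh * m j) + εh * (εY * (X - 1)) * (a j * (1 / εY - 1) - m j - e j) +
        (εg + εh) * (R - 1) * (e j - εh * (a j + m j + e j)) +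
        εh * (ν * ((εY * (X - 1) + a j * X) * (R * (1 + e j / εh) - 1) -
          εY * (X - 1) * (R - 1) * (1 + a j + m j + e j))) := by
    field_simp
    ring
  have h5 : 0 ≤ εh * ((1 + εY * ((1 + a j / εY) * X - 1) + (εg + εh) * ((1 + e j / εh) * R - 1) +
      ν * (εY * ((1 + a j / εY) * X - 1)) * ((1 + e j / εh) * R - 1)) -
      (1 + a j + m j + e j) * (1 + εY * (X - 1) + (εg + εh) * (R - 1) + ν * (εY * (X - 1)) * (R - 1))) := by
    rw [hid]; exact hΔ
  have h6 := (mul_nonneg_iff_of_pos_left hεh).1 h5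
  calc (1 + a j + m j + e j) * ∏ i ∈ T, (1 + a i + m i + e i)
      ≤ (1 + a j + m j + e j) * (1 + εY * (X - 1) + (εg + εh) * (R - 1) + ν * (εY * (X - 1)) * (R - 1)) :=
        mul_le_mul_of_nonneg_left IH' hVj
    _ ≤ 1 + εY * ((1 + a j / εY) * X - 1) + (εg + εh) * ((1 + e j / εh) * R - 1) +
        ν * (εY * ((1 + a j / εY) * X - 1)) * ((1 + e j / εh) * R - 1) := by linarith



end LinkedCurrency

end SafeCalc

end Summit.CriticalPhenomena.PercolationContinuityZ3.Theorems.SunflowerPartition
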